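import Literature.MathematicalPhysics.QuantumLattice.FinDimSpectrum
import Mathlib.Analysis.Analytic.Constructions
import Mathlib.Analysis.Analytic.Composition
import Mathlib.Analysis.Normed.Algebra.Exponential
import HarnessLib

/-!
# Finite-volume Gibbs expectations are analytic in the coupling

Topic `Literature/MathematicalPhysics/QuantumLattice`.  The thermodynamic limit of the Schwinger
functions in constructive fermionic renormalization is taken on quantities that, at finite volume,
are analytic functions of the coupling `U` (ratios of traces of `e^{-β(H₀ + U V)}`; the content of
the multiscale analysis is a radius of analyticity *uniform* in the volume — Benfatto–Giuliani–
Mastropietro 2006, §1–§2; cf. `Literature/Analysis/Complex/BoundedAnalyticFamilyLimit.lean` for the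
limit step).  This file proves the finite-volume half at the level of matrices: for
`H(U) = H₀ + U • V`, `U ∈ ℂ`,

* `analyticAt_gibbsWeight_affine` — `U ↦ e^{-β H(U)}` is analytic (entire);
* `analyticAt_partitionFn_affine`, `analyticAt_trace_gibbsWeight_mul` — so are `Z(U) = tr e^{-βH(U)}`
  and `tr (e^{-βH(U)} A)`;
* `analyticAt_thermalCorr_affine` — the thermal correlation `⟨A B⟩_{β, H(U)} = tr(e^{-βH(U)}AB)/Z(U)`
  is analytic at every `U₀` with `Z(U₀) ≠ 0`, in particular (`analyticAt_thermalCorr_affine_ofReal`)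
  at every real `U₀` when `H₀, V` are Hermitian.

Everything is proved; no named fact. [folklore]

## Sources

G. Benfatto, A. Giuliani, V. Mastropietro, Ann. Henri Poincaré 7 (2006), §1 (finite volume,
`β, L` finite) and the remark after Thm. 2.1 (`BenfattoGiulianiMastropietro2006`); O. Bratteli,
D. W. Robinson, *Operator Algebras and Quantum Statistical Mechanics II*, §5.3.1 (finite-volume
Gibbs states).
-/

noncomputable section

open scoped Matrix.Norms.L2Operator ComplexOrder

namespace Literature.MathematicalPhysics.QuantumLattice

open Matrix

variable {n : Type*} [Fintype n] [DecidableEq n]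

/-- The affine family of Hamiltonians `H(U) = H₀ + U V` is analytic in `U`. [folklore] -/
theorem analyticAt_affine (H₀ V : Matrix n n ℂ) (U₀ : ℂ) :
    AnalyticAt ℂ (fun U : ℂ => H₀ + U • V) U₀ :=
  analyticAt_const.add (analyticAt_id.smul analyticAt_const)

/-- **`U ↦ e^{-β(H₀ + U V)}` is analytic** (entire). [folklore] -/
theorem analyticAt_gibbsWeight_affine (β : ℝ) (H₀ V : Matrix n n ℂ) (U₀ : ℂ) :
    AnalyticAt ℂ (fun U : ℂ => gibbsWeight β (H₀ + U • V)) U₀ := by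
  unfold gibbsWeight
  have h : AnalyticAt ℂ (fun U : ℂ => -(β : ℂ) • (H₀ + U • V)) U₀ :=
    (analyticAt_const (v := -(β : ℂ))).smul (analyticAt_affine H₀ V U₀)
  exact (NormedSpace.exp_analytic _).comp h

/-- `U ↦ tr (e^{-β(H₀ + U V)} A)` is analytic. [folklore] -/
theorem analyticAt_trace_gibbsWeight_mul (β : ℝ) (H₀ V A : Matrix n n ℂ) (U₀ : ℂ) :
    AnalyticAt ℂ (fun U : ℂ => (gibbsWeight β (H₀ + U • V) * A).trace) U₀ :=
  (Matrix.traceLinearMap n ℂ ℂ).toContinuousLinearMap.analyticAt _ |>.comp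
    ((analyticAt_gibbsWeight_affine β H₀ V U₀).mul analyticAt_const)

/-- `U ↦ Z(U) = tr e^{-β(H₀ + U V)}` is analytic. [folklore] -/
theorem analyticAt_partitionFn_affine (β : ℝ) (H₀ V : Matrix n n ℂ) (U₀ : ℂ) :
    AnalyticAt ℂ (fun U : ℂ => partitionFn β (H₀ + U • V)) U₀ := by
  have h := analyticAt_trace_gibbsWeight_mul β H₀ V 1 U₀
  simp only [mul_one] at h
  exact h

/-- **The finite-volume thermal correlation is analytic in the coupling** wherever the partition
function does not vanish: `U ↦ ⟨A B⟩_{β, H₀ + U V}` is analytic at `U₀` if `Z(U₀) ≠ 0`. [folklore] -/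
theorem analyticAt_thermalCorr_affine (β : ℝ) (H₀ V A B : Matrix n n ℂ) {U₀ : ℂ}
    (hZ : partitionFn β (H₀ + U₀ • V) ≠ 0) :
    AnalyticAt ℂ (fun U : ℂ => thermalCorr β (H₀ + U • V) A B) U₀ := by
  have hf := analyticAt_trace_gibbsWeight_mul β H₀ V (A * B) U₀
  have hg := analyticAt_partitionFn_affine β H₀ V U₀
  have h := (hg.inv hZ).mul hf
  refine h.congr (Filter.Eventually.of_forall fun U => ?_)
  simp only [Pi.mul_apply, Pi.inv_apply, thermalCorr, gibbsState_apply]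

/-- In particular, for Hermitian `H₀, V` (and a nonempty state space) the thermal correlation is
analytic at every **real** coupling (`Z > 0` there), i.e. the finite-volume Schwinger functions are
real-analytic in `U` and extend analytically to a complex neighbourhood of the real axis
(Benfatto–Giuliani–Mastropietro 2006, §1). [cite: BenfattoGiulianiMastropietro2006, §1] -/
theorem analyticAt_thermalCorr_affine_ofReal [Nonempty n] (β : ℝ) {H₀ V : Matrix n n ℂ} (hH₀ : H₀.IsHermitian)
    (hV : V.IsHermitian) (A B : Matrix n n ℂ) (U₀ : ℝ) :
    AnalyticAt ℂ (fun U : ℂ => thermalCorr β (H₀ + U • V) A B) (U₀ : ℂ) := by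
  refine analyticAt_thermalCorr_affine β H₀ V A B (ne_of_gt ?_)
  have hH : (H₀ + (U₀ : ℂ) • V).IsHermitian := by
    refine hH₀.add ?_
    unfold Matrix.IsHermitian
    rw [conjTranspose_smul, hV.eq, Complex.star_def, Complex.conj_ofReal]
  exact partitionFn_pos β hH

end Literature.MathematicalPhysics.QuantumLattice
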